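import Literature.NumberTheory.EllipticCurves.NewformSymmSquarePairPositivity
import Literature.NumberTheory.LFunctions.SelbergClassEulerMatchContinuation
import Literature.NumberTheory.LFunctions.EdgeOfConvergenceBound
import Literature.NumberTheory.LFunctions.ZetaClassicalRegionBounds
import HarnessLib

/-!
# Murty's bound `(f, f) ≫_ε N^{1−ε}` from SELBERG-CLASS membership of the pair `L`-functions
# `L(s, Sym² f_i × Sym² f_j)` (Hoffstein–Lockhart's input in the Selberg-class currency)

Topic `NumberTheory/EllipticCurves`; namespace `Literature.NumberTheory.EllipticCurves.ModularForms`.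
Theorems and ONE predicate with a body (`IsSymmSqPairSelbergDatum`); no named fact (D-0026). Filed in
support of the named fact `murty_petersson_newform_lower_bound` (`NewformPeterssonSize.lean`).

After `NewformSymmSquarePairPositivity` (the explicit pair function
`pairP i j = ∏_p ∏_{a,b<3} (1 − S_i(p)_a S_j(p)_b p^{−s})⁻¹`, its coefficient positivity `pair_coeff₃`,
and `murty_petersson_newform_lower_bound_of_pairContinuation`) the named fact follows from: for every
pair of non-CM, non-twist-equivalent elliptic newforms, `pairP i j` agrees on `Re s > 1` with a
function `G_{ij}` holomorphic on `|s − 2| < 3/2` with (a) `‖G_{ij}‖ ≤ B₂(N_iN_j)^{κ₂}` on the closed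
disc and (b) `|G_{ij}(1)| ≤ T(η)(N_iN_j)^η` for every `η > 0`. This file

* PROVES that (b) follows from (a) (`murty_petersson_newform_lower_bound_of_pairContinuation'`):
  Hadamard's three circles at the edge of absolute convergence
  (`Literature.NumberTheory.LFunctions.exists_norm_le_mul_rpow_of_edgeBound`) with the trivial bound
  `‖pairP i j s‖ ≤ (σ/(σ−1))⁹` (`norm_pairP_le`: nine completely multiplicative unitary letters);
* states the remaining input in the vocabulary of the tree's Selberg class
  (`Literature.NumberTheory.LFunctions.SelbergDatum`, `SelbergClass.lean`): the predicate
  `IsSymmSqPairSelbergDatum i j m D` — "`D` is a Selberg datum for `L(s, Sym² f_i × Sym² f_j)`": no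
  pole, the same Euler factors as `pairP i j` at the primes `p ∤ N_iN_j`, and at each `p ∣ N_iN_j` at
  most `m` inverse linear factors `(1 − β p^{−s})⁻¹` with `|β| ≤ 1` (the shape of the ramified
  Rankin–Selberg factors of a pair of tempered representations, Jacquet–Piatetski-Shapiro–Shalika);
* PROVES the reduction `murty_petersson_newform_lower_bound_of_pair_selbergData`: **if for the non-CM,
  non-twist-equivalent pairs there are such data in a bounded shape class (`numGamma ≤ n`,
  `λ₀ ≤ λ_k ≤ Λ₀`, `‖μ_k‖ ≤ M₀`) with `Q ≤ c₁ (N_iN_j)^{c₂}`, then `murty_petersson_newform_lower_bound`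
  holds.** The engine is `SelbergDatum.exists_continuation_of_eulerMatch`
  (`LFunctions/SelbergClassEulerMatchContinuation`: uniform convexity
  `SelbergDatum.exists_uniform_norm_pow_mul_toFun_le` on the box `1/2 ≤ Re s ≤ 7/2`, `|Im s| ≤ 3/2`
  from the universal bound `3⁹ e^{(9+2m)∑ n^{−3/2}}` on `Re s ≥ 3/2`, continuity at `s = 1`, and the
  bad-factor bookkeeping `‖∏(1 − β p^{−s})‖ ≤ (N_iN_j)^m`, `‖(∏(1 − v p^{−s}))⁻¹‖ ≤ (N_iN_j)^{18}` on
  `Re s ≥ 1/2`), fed with `‖pairP‖ ≤ 3⁹` on `Re s ≥ 3/2` (`norm_pairP_le_of_three_halves_le`).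

In print the hypothesis is: the Gelbart–Jacquet lift `Π_i = Sym² π_{f_i}` is a cuspidal automorphic
representation of `GL₃(𝔸_ℚ)` for non-CM `f_i` [GelbartJacquet1978, Thm. 9.3], `Π_i ≇ Π_j` for
non-twist-equivalent `f_i, f_j`, and the Rankin–Selberg `L`-function `L(s, Π_i × Π_j)` is then entire,
bounded in vertical strips, with the functional equation of Jacquet–Piatetski-Shapiro–Shalika /
Mœglin–Waldspurger and conductor `≤ (N_iN_j)^{O(1)}` [HoffsteinLockhart1994, §1, Lemma 1.2 and (1.4)]
— i.e. a Selberg datum in the above sense. This is the Siegel-type (ineffective) route of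
Hoffstein–Lockhart's Theorem 0.1 as printed; the alternative effective route through the symmetric
fourth power is `NewformPeterssonSizeSymmFourReductionProofs` (input: the named fact
`Literature.NumberTheory.Automorphic.Kim2003_symmFourL_nonCM_entire_polyBound`, itself reduced to a
Selberg datum for `L(s, Sym⁴ f)` in `Automorphic/KimSymmetricFourthGL2Reduction`). No GL₃ object is
constructed here; the automorphic input is a HYPOTHESIS of the reduction theorem, never asserted.

Erratum (same author): the earlier carrier `symmSqPairL f₁ f₂ = ζ(s) L(q, s)` of
`RankinSymmSquarePairSeries` equals `ζ(2s)² ∏_{p∣N₁N₂}(1 − p^{−s})(1 + p^{−s})² L^{(N₁N₂)}(s, Sym² f₁ × Sym² f₂)`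
and so carries the double pole of `ζ(2s)²` at `s = 1/2 ∈ ∂{|s − 2| < 3/2}`; the hypothesis of
`murty_petersson_newform_lower_bound_of_exists_symmSqPairL_continuation_nonCM`
(`NewformPeterssonSizePairAnalyticReductionProofs`), a bound on the CLOSED disc, would force a double
zero of `L^{(N₁N₂)}(s, Sym² f₁ × Sym² f₂)` at `s = 1/2` and is not the statement to aim for; the
pole-free carrier `pairP` of `NewformSymmSquarePairPositivity` is, and this file builds on it.

## References

* J. Hoffstein, P. Lockhart, *Coefficients of Maass forms and the Siegel zero* (appendix by
  D. Goldfeld, J. Hoffstein, D. Lieman), Ann. of Math. 140 (1994), 161–181: Thm. 0.1, §1, Lemma 1.2,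
  (1.4). [cite: HoffsteinLockhart1994, Thm. 0.1, §1 Lemma 1.2]
* S. Gelbart, H. Jacquet, *A relation between automorphic representations of GL(2) and GL(3)*,
  Ann. Sci. ÉNS 11 (1978), Thm. 9.3. [cite: GelbartJacquet1978, Thm. 9.3]
* H. Iwaniec, E. Kowalski, *Analytic Number Theory* (2004), §5.1 (ramified local factors, (5.3)),
  §5.2 (5.20)–(5.21) (convexity). [cite: IwaniecKowalski2004, §5.1–5.2]
* M. R. Murty, *Bounds for congruence primes*, Proc. Sympos. Pure Math. 66.1 (1999), §2.
  [cite: MurtyCongruencePrimes1999, §2]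

## Mathlib / tree search

Tree: `pairP`, `pairPFun`, `norm_pairPFun_le`, `murty_petersson_newform_lower_bound_of_pairContinuation`
(`NewformSymmSquarePairPositivity`); `EulerParam.LSeries_eulerFun`, `EulerParam.norm_chiFun_le`
(`LFunctions/EulerProductPowerSumPositivity`); `SelbergDatum`, `SelbergDatum.exists_uniform_norm_pow_mul_toFun_le`
(`LFunctions/SelbergClass`, `LFunctions/SelbergClassUniformConvexity`);
`exists_norm_le_mul_rpow_of_edgeBound` (`LFunctions/EdgeOfConvergenceBound`);
`SelbergDatum.exists_continuation_of_eulerMatch` (`LFunctions/SelbergClassEulerMatchContinuation`);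
`ZetaClassicalRegion.norm_LSeries_le_of_norm_le_one` (`LFunctions/ZetaClassicalRegionBounds`); the
pattern of `Automorphic/KimSymmetricFourthGL2Reduction` (`IsSymmFourSelbergDatum`,
`Kim2003_symmFourL_nonCM_entire_polyBound_of_selbergData`). Mathlib: `Nat.prod_primeFactors_dvd`,
`Real.rpow_add`, `Real.rpow_natCast`, `Metric.ball_subset_ball'`.
-/

noncomputable section

open scoped Real
open Complex Metric Set Filter Topology
open Literature.NumberTheory.LFunctions
open Literature.NumberTheory.LFunctions.EulerParam (eulerFun chiFun LSeries_eulerFun norm_chiFun_le)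
open Literature.NumberTheory.LFunctions.ZetaClassicalRegion (norm_LSeries_le_of_norm_le_one)

namespace Literature.NumberTheory.EllipticCurves.ModularForms

/-! ### The trivial bound `‖P_{ij}(s)‖ ≤ (σ/(σ−1))⁹` on `Re s > 1` -/

/-- **`‖P_{ij}(s)‖ ≤ (σ/(σ − 1))⁹`** for `σ = Re s > 1`: `P_{ij} = ∏_{l<9} L(s, χ_l)` with completely
multiplicative `χ_l` of modulus `≤ 1` (`EulerParam.LSeries_eulerFun`), and `|L(s, χ_l)| ≤ ζ(σ) ≤ σ/(σ−1)`.
[folklore] -/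
theorem norm_pairP_le (i j : EllipticNewformIndex) {s : ℂ} (hs : 1 < s.re) :
    ‖pairP i j s‖ ≤ (s.re / (s.re - 1)) ^ (3 * 3) := by
  have hc : ∀ l (p : ℕ), p.Prime → ‖pairPFun i j l p‖ ≤ 1 := fun l p hp ↦ norm_pairPFun_le i j l p hp
  unfold pairP
  rw [LSeries_eulerFun hc hs, norm_prod]
  calc ∏ l, ‖LSeries (⇑(chiFun (pairPFun i j l))) s‖
      ≤ ∏ _l : Fin (3 * 3), (s.re / (s.re - 1)) :=
        Finset.prod_le_prod (fun _ _ ↦ norm_nonneg _)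
          (fun l _ ↦ norm_LSeries_le_of_norm_le_one (norm_chiFun_le (hc l)) hs)
    _ = (s.re / (s.re - 1)) ^ (3 * 3) := by
        rw [Finset.prod_const, Finset.card_univ, Fintype.card_fin]

/-- `‖P_{ij}(s)‖ ≤ 3⁹` for `Re s ≥ 3/2`. [folklore] -/
theorem norm_pairP_le_of_three_halves_le (i j : EllipticNewformIndex) {s : ℂ} (hs : 3 / 2 ≤ s.re) :
    ‖pairP i j s‖ ≤ (3 : ℝ) ^ (3 * 3) := by
  refine (norm_pairP_le i j (by linarith)).trans (pow_le_pow_left₀ (by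
    apply div_nonneg <;> linarith) ?_ _)
  rw [div_le_iff₀ (by linarith)]
  linarith

/-- `‖P_{ij}(s)‖ ≤ (3/2)⁹/(σ − 1)⁹` for `1 < σ = Re s ≤ 3/2`. [folklore] -/
theorem norm_pairP_le_div (i j : EllipticNewformIndex) {s : ℂ} (hs : 1 < s.re) (hs2 : s.re ≤ 3 / 2) :
    ‖pairP i j s‖ ≤ (3 / 2 : ℝ) ^ (3 * 3) / (s.re - 1) ^ (3 * 3) := by
  refine (norm_pairP_le i j hs).trans ?_
  rw [div_pow]
  exact div_le_div_of_nonneg_right (pow_le_pow_left₀ (by linarith) hs2 _) (pow_nonneg (by linarith) _)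

/-! ### The value bound at `s = 1` follows from the disc bound -/

section Reduction

open _root_.WeierstrassCurve

/-- **Murty's bound from a continuation of the pair functions with a disc bound only.** The
hypothesis `hG1` (`|G_{ij}(1)| ≤ T(η)(N_iN_j)^η` for every `η > 0`) of
`murty_petersson_newform_lower_bound_of_pairContinuation` follows from the disc bound `hGle`: three
circles centred `1 + η'` through `1 + η'/2` (where `G_{ij} = P_{ij}` is `≤ (3/2)⁹(σ−1)^{−9}`,
`norm_pairP_le_div`), `1` and `1 + 1/4` (where `‖G_{ij}‖ ≤ B₂(N_iN_j)^{κ₂}`) —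
`exists_norm_le_mul_rpow_of_edgeBound` with `ε = η/(κ₂ + 1)`. So the named fact follows from:
for the non-CM, non-twist-equivalent pairs, `P_{ij}` continues to a holomorphic function on
`|s − 2| < 3/2` bounded by `B₂(N_iN_j)^{κ₂}` on the closed disc.
[cite: HoffsteinLockhart1994, Thm. 0.1, §1 Lemma 1.2] -/
theorem murty_petersson_newform_lower_bound_of_pairContinuation'
    (G : EllipticNewformIndex → EllipticNewformIndex → ℂ → ℂ)
    (hGd : ∀ i j, ¬ i.W.HasCM → ¬ j.W.HasCM → ¬ TwistEquiv i j →
      DifferentiableOn ℂ (G i j) (ball (2 : ℂ) (3 / 2)))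
    (hGeq : ∀ i j, ¬ i.W.HasCM → ¬ j.W.HasCM → ¬ TwistEquiv i j →
      ∀ s : ℂ, 1 < s.re → G i j s = pairP i j s)
    {B₂ κ₂ : ℝ} (hB₂ : 0 ≤ B₂) (hκ₂ : 0 ≤ κ₂)
    (hGle : ∀ i j, ¬ i.W.HasCM → ¬ j.W.HasCM → ¬ TwistEquiv i j → ∀ s ∈ closedBall (2 : ℂ) (3 / 2),
      ‖G i j s‖ ≤ B₂ * ((i.N : ℝ) * j.N) ^ κ₂) :
    murty_petersson_newform_lower_bound := by
  refine murty_petersson_newform_lower_bound_of_pairContinuation G hGd hGeq hB₂ hκ₂ hGle ?_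
  intro η hη
  set ε : ℝ := η / (κ₂ + 1) with hε
  have hε0 : 0 < ε := by rw [hε]; positivity
  obtain ⟨C, hC, hedge⟩ :=
    exists_norm_le_mul_rpow_of_edgeBound (3 * 3) (r := 1 / 2) (by norm_num) hε0
  set B' : ℝ := max 1 B₂ with hB'
  have hB'1 : 1 ≤ B' := le_max_left _ _
  have hB₂B' : B₂ ≤ B' := le_max_right _ _
  set A : ℝ := (3 / 2 : ℝ) ^ (3 * 3) with hA
  have hA0 : 0 ≤ A := by rw [hA]; positivity
  refine ⟨C * (A + 1) * B' ^ ε, fun i j hi hj hij ↦ ?_⟩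
  set Q₀ : ℝ := (i.N : ℝ) * j.N with hQ₀
  have hiN : (1 : ℝ) ≤ i.N := by exact_mod_cast Nat.one_le_iff_ne_zero.mpr (NeZero.ne i.N)
  have hjN : (1 : ℝ) ≤ j.N := by exact_mod_cast Nat.one_le_iff_ne_zero.mpr (NeZero.ne j.N)
  have hQ₀1 : 1 ≤ Q₀ := by rw [hQ₀]; nlinarith
  have hQ₀0 : 0 < Q₀ := by linarith
  set M : ℝ := B' * Q₀ ^ κ₂ with hM
  have hQκ : 1 ≤ Q₀ ^ κ₂ := Real.one_le_rpow hQ₀1 hκ₂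
  have hM1 : 1 ≤ M := by rw [hM]; nlinarith
  -- the small disc `|s - 1| < 1/2` lies in the big one
  have hsub : ball (1 : ℂ) (1 / 2) ⊆ ball (2 : ℂ) (3 / 2) := by
    apply ball_subset_ball'
    rw [dist_eq_norm, show (1 : ℂ) - 2 = -1 by ring, norm_neg, norm_one]
    norm_num
  have hsub' : ball (1 : ℂ) (1 / 2) ⊆ closedBall (2 : ℂ) (3 / 2) := hsub.trans ball_subset_closedBall
  have hdiff : DifferentiableOn ℂ (G i j) (ball (1 : ℂ) (1 / 2)) := (hGd i j hi hj hij).mono hsub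
  have hbound : ∀ s ∈ ball (1 : ℂ) (1 / 2), ‖G i j s‖ ≤ M := by
    intro s hs
    refine (hGle i j hi hj hij s (hsub' hs)).trans ?_
    rw [hM]
    exact mul_le_mul_of_nonneg_right hB₂B' (by linarith)
  have htriv : ∀ s ∈ ball (1 : ℂ) (1 / 2), (1 : ℂ).re < s.re →
      ‖G i j s‖ ≤ A / (s.re - (1 : ℂ).re) ^ (3 * 3) := by
    intro s hs hre
    rw [Complex.one_re] at hre ⊢
    rw [mem_ball, dist_eq_norm] at hs
    have h1 : |(s - 1).re| ≤ ‖s - 1‖ := abs_re_le_norm _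
    rw [sub_re, Complex.one_re] at h1
    have hs2 : s.re ≤ 3 / 2 := by have := (abs_le.mp (h1.trans hs.le)).2; linarith
    rw [hGeq i j hi hj hij s hre, hA]
    exact norm_pairP_le_div i j hre hs2
  have key := hedge (G i j) 1 A M hA0 hM1 hdiff hbound htriv
  -- `M^ε = B'^ε Q₀^{κ₂ ε} ≤ B'^ε Q₀^η`
  have hMε : M ^ ε ≤ B' ^ ε * Q₀ ^ η := by
    rw [hM, Real.mul_rpow (by linarith) (by linarith), ← Real.rpow_mul hQ₀0.le]
    refine mul_le_mul_of_nonneg_left (Real.rpow_le_rpow_of_exponent_le hQ₀1 ?_)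
      (Real.rpow_nonneg (by linarith) _)
    rw [hε, mul_div_assoc']
    rw [div_le_iff₀ (by linarith)]
    nlinarith
  calc ‖G i j 1‖ ≤ C * (A + 1) * M ^ ε := key
    _ ≤ C * (A + 1) * (B' ^ ε * Q₀ ^ η) := mul_le_mul_of_nonneg_left hMε (by positivity)
    _ = C * (A + 1) * B' ^ ε * ((i.N : ℝ) * j.N) ^ η := by rw [hQ₀]; ring

end Reduction




/-! ### The input in the Selberg-class currency -/

section Selberg

open _root_.WeierstrassCurve

/-- **"`D` is a Selberg datum for `L(s, Sym² f_i × Sym² f_j)`"** (`m` = the number of local factors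
allowed at a bad prime): `D` has no pole (`polarOrder = 0`) and its function `F = D.toFun` has the same
Euler factors as the explicit pair function `P_{ij} = pairP i j` at the primes `p ∤ N_iN_j`, and at each
`p ∣ N_iN_j` at most `m` inverse linear factors `(1 − β_{p,k} p^{−s})⁻¹` with `|β_{p,k}| ≤ 1`; stated as
the identity `P_{ij}(s) ∏_{p∣N_iN_j}∏_{l<9}(1 − v_{p,l} p^{−s}) = F(s) ∏_{p∣N_iN_j}∏_{k<m}(1 − β_{p,k} p^{−s})`
on `Re s > 1` (`v_{p,l} = pairPFun i j l p`, the explicit letters of `P_{ij}` at `p`, of modulus `≤ 1`).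
In print: `F = L(s, Π_i × Π_j)` for the Gelbart–Jacquet lifts `Π = Sym² π_f` (cuspidal on `GL₃(𝔸_ℚ)`
for non-CM `f`), whose unramified factors are the nine-letter factors of `P_{ij}` and whose ramified
factors have the stated shape for tempered `Π_{i,p}, Π_{j,p}` (Jacquet–Piatetski-Shapiro–Shalika;
Iwaniec–Kowalski §5.1 (5.3) with `|α| ≤ 1`). A predicate on data, not an assertion.
[cite: HoffsteinLockhart1994, §1 Lemma 1.2] [cite: IwaniecKowalski2004, §5.1 (5.1)–(5.3)] -/
def IsSymmSqPairSelbergDatum (i j : EllipticNewformIndex) (m : ℕ) (D : SelbergDatum) : Prop :=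
  D.polarOrder = 0 ∧
    ∃ β : ℕ → Fin m → ℂ, (∀ p k, ‖β p k‖ ≤ 1) ∧
      ∀ s : ℂ, 1 < s.re →
        pairP i j s * ∏ p ∈ (i.N * j.N).primeFactors, ∏ l : Fin (3 * 3),
            (1 - pairPFun i j l p * (p : ℂ) ^ (-s)) =
          D.toFun s * ∏ p ∈ (i.N * j.N).primeFactors, ∏ k : Fin m, (1 - β p k * (p : ℂ) ^ (-s))

/-- Unfolding of `IsSymmSqPairSelbergDatum`. [folklore] -/
theorem isSymmSqPairSelbergDatum_iff (i j : EllipticNewformIndex) (m : ℕ) (D : SelbergDatum) :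
    IsSymmSqPairSelbergDatum i j m D ↔
      D.polarOrder = 0 ∧
        ∃ β : ℕ → Fin m → ℂ, (∀ p k, ‖β p k‖ ≤ 1) ∧
          ∀ s : ℂ, 1 < s.re →
            pairP i j s * ∏ p ∈ (i.N * j.N).primeFactors, ∏ l : Fin (3 * 3),
                (1 - pairPFun i j l p * (p : ℂ) ^ (-s)) =
              D.toFun s * ∏ p ∈ (i.N * j.N).primeFactors, ∏ k : Fin m,
                (1 - β p k * (p : ℂ) ^ (-s)) := Iff.rfl

/-- **A Selberg datum for `L(s, Sym² f_i × Sym² f_j)` continues `P_{ij}` with a polynomial bound.**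
For a shape class (`numGamma ≤ n`, `λ₀ ≤ λ_k ≤ Λ₀`, `‖μ_k‖ ≤ M₀`) and `m` there are `C > 0`, `K ≥ 0`
with: for every pair `(i, j)` and every datum `D` of the class with `IsSymmSqPairSelbergDatum i j m D`,
`P_{ij}` agrees on `Re s > 1` with a function holomorphic on `|s − 2| < 3/2` and bounded by
`C max(1, Q)^K (N_iN_j)^{m+18}` on `|s − 2| ≤ 3/2` (`SelbergDatum.exists_continuation_of_eulerMatch` with
`S` = the primes dividing `N_iN_j`, `∏_{p∈S} p ≤ N_iN_j`, `P₀ = 3⁹`).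
[cite: IwaniecKowalski2004, §5.2 (5.20)–(5.21)] -/
theorem exists_pairContinuation_of_isSymmSqPairSelbergDatum (n m : ℕ) {lam₀ : ℝ} (hlam₀ : 0 < lam₀)
    (Λ₀ M₀ : ℝ) :
    ∃ C K : ℝ, 0 < C ∧ 0 ≤ K ∧ ∀ (i j : EllipticNewformIndex) (D : SelbergDatum),
      IsSymmSqPairSelbergDatum i j m D → D.numGamma ≤ n →
      (∀ k, lam₀ ≤ D.lam k) → (∀ k, D.lam k ≤ Λ₀) → (∀ k, ‖D.mu k‖ ≤ M₀) →
      ∃ G : ℂ → ℂ, DifferentiableOn ℂ G (ball (2 : ℂ) (3 / 2)) ∧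
        (∀ s : ℂ, 1 < s.re → G s = pairP i j s) ∧
        ∀ s ∈ closedBall (2 : ℂ) (3 / 2),
          ‖G s‖ ≤ C * max 1 D.Q ^ K * ((i.N : ℝ) * j.N) ^ (m + 18) := by
  obtain ⟨C, K, hC, hK, hcont⟩ :=
    SelbergDatum.exists_continuation_of_eulerMatch n m (3 * 3) hlam₀ Λ₀ M₀ ((3 : ℝ) ^ (3 * 3))
  refine ⟨C, K, hC, hK, fun i j D hD hn hlam hΛ hμ ↦ ?_⟩
  obtain ⟨hm0, β, hβ, hEq⟩ := hD
  set S : Finset ℕ := (i.N * j.N).primeFactors with hSdef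
  have hS : ∀ p ∈ S, p.Prime := fun p hp ↦ Nat.prime_of_mem_primeFactors hp
  have hv : ∀ p ∈ S, ∀ l : Fin (3 * 3), ‖pairPFun i j l p‖ ≤ 1 :=
    fun p hp l ↦ norm_pairPFun_le i j l p (hS p hp)
  obtain ⟨G, hGd, hGeq, hGle⟩ := hcont S hS (pairP i j)
    (fun s hs ↦ norm_pairP_le_of_three_halves_le i j hs) (fun p l ↦ pairPFun i j l p) hv D hm0 hn
    hlam hΛ hμ β (fun p _ k ↦ hβ p k) hEq
  refine ⟨G, hGd, hGeq, fun s hs ↦ (hGle s hs).trans ?_⟩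
  -- `∏_{p ∣ N_iN_j} p ≤ N_iN_j`
  have hN0 : i.N * j.N ≠ 0 := mul_ne_zero (NeZero.ne i.N) (NeZero.ne j.N)
  have hrad : (((∏ p ∈ S, p : ℕ) : ℝ)) ≤ (i.N : ℝ) * j.N := by
    have := Nat.le_of_dvd (Nat.pos_of_ne_zero hN0) (Nat.prod_primeFactors_dvd (i.N * j.N))
    exact_mod_cast this
  have h18 : m + 2 * (3 * 3) = m + 18 := by ring
  rw [h18]
  exact mul_le_mul_of_nonneg_left (pow_le_pow_left₀ (by positivity) hrad _) (by positivity)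

/-- **Murty's bound `(f, f) ≫_ε N^{1−ε}` from Selberg-class membership of the pair `L`-functions.**
Suppose that for some shape class (`numGamma ≤ n`, `λ₀ ≤ λ_k ≤ Λ₀`, `‖μ_k‖ ≤ M₀`), some `m` and
`c₁, c₂`, every pair `(f_i, f_j)` of newforms of non-CM, non-twist-equivalent elliptic curves over `ℚ`
admits a Selberg datum `D` for `L(s, Sym² f_i × Sym² f_j)` in the sense of `IsSymmSqPairSelbergDatum`
with `Q ≤ c₁ (N_iN_j)^{c₂}` — in print: `Sym² π_{f_i}` is cuspidal on `GL₃(𝔸_ℚ)` (Gelbart–Jacquet,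
non-CM), `Sym² π_{f_i} ≇ Sym² π_{f_j}` (non-twist-equivalent), and `L(s, Sym² f_i × Sym² f_j)` is
entire with the Jacquet–Piatetski-Shapiro–Shalika / Mœglin–Waldspurger functional equation, gamma
factors of a fixed shape and conductor `≤ (N_iN_j)^{O(1)}` (Hoffstein–Lockhart §1, Lemma 1.2 and
(1.4)). Then `murty_petersson_newform_lower_bound` holds: the continuation and disc bound come from
`exists_pairContinuation_of_isSymmSqPairSelbergDatum`, the value bound at `s = 1` from
`murty_petersson_newform_lower_bound_of_pairContinuation'`, the coefficient positivity and the CM side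
being proved in `NewformSymmSquarePairPositivity` / `NewformSymmSquareJ0Hecke`.
[cite: HoffsteinLockhart1994, Thm. 0.1, §1 Lemma 1.2] [cite: GelbartJacquet1978, Thm. 9.3]
[cite: MurtyCongruencePrimes1999, §2] -/
theorem murty_petersson_newform_lower_bound_of_pair_selbergData
    (h : ∃ (n m : ℕ) (lam₀ Λ₀ M₀ c₁ c₂ : ℝ), 0 < lam₀ ∧
      ∀ i j : EllipticNewformIndex, ¬ i.W.HasCM → ¬ j.W.HasCM → ¬ TwistEquiv i j →
        ∃ D : SelbergDatum, IsSymmSqPairSelbergDatum i j m D ∧ D.numGamma ≤ n ∧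
          (∀ k, lam₀ ≤ D.lam k ∧ D.lam k ≤ Λ₀ ∧ ‖D.mu k‖ ≤ M₀) ∧
          D.Q ≤ c₁ * ((i.N : ℝ) * j.N) ^ c₂) :
    murty_petersson_newform_lower_bound := by
  classical
  obtain ⟨n, m, lam₀, Λ₀, M₀, c₁, c₂, hlam₀, hfam⟩ := h
  obtain ⟨C, K, hC, hK, hcont⟩ := exists_pairContinuation_of_isSymmSqPairSelbergDatum n m hlam₀ Λ₀ M₀
  -- constants
  set c₁' : ℝ := max 1 c₁ with hc₁'
  have hc₁'1 : 1 ≤ c₁' := le_max_left _ _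
  set c₂' : ℝ := max c₂ 0 with hc₂'
  have hc₂'0 : 0 ≤ c₂' := le_max_right _ _
  set B₂ : ℝ := C * c₁' ^ K with hB₂
  have hB₂0 : 0 ≤ B₂ := by rw [hB₂]; positivity
  set κ₂ : ℝ := K * c₂' + (m + 18 : ℕ) with hκ₂
  have hκ₂0 : 0 ≤ κ₂ := by rw [hκ₂]; positivity
  -- the continuation for each relevant pair, with the bound `B₂ (N_iN_j)^{κ₂}`
  have hpair : ∀ i j : EllipticNewformIndex, ¬ i.W.HasCM → ¬ j.W.HasCM → ¬ TwistEquiv i j →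
      ∃ G : ℂ → ℂ, DifferentiableOn ℂ G (ball (2 : ℂ) (3 / 2)) ∧
        (∀ s : ℂ, 1 < s.re → G s = pairP i j s) ∧
        ∀ s ∈ closedBall (2 : ℂ) (3 / 2), ‖G s‖ ≤ B₂ * ((i.N : ℝ) * j.N) ^ κ₂ := by
    intro i j hi hj hij
    obtain ⟨D, hD, hn, hshape, hQ⟩ := hfam i j hi hj hij
    obtain ⟨G, hGd, hGeq, hGle⟩ := hcont i j D hD hn (fun k ↦ (hshape k).1)
      (fun k ↦ (hshape k).2.1) (fun k ↦ (hshape k).2.2)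
    refine ⟨G, hGd, hGeq, fun s hs ↦ (hGle s hs).trans ?_⟩
    set Q₀ : ℝ := (i.N : ℝ) * j.N with hQ₀
    have hiN : (1 : ℝ) ≤ i.N := by exact_mod_cast Nat.one_le_iff_ne_zero.mpr (NeZero.ne i.N)
    have hjN : (1 : ℝ) ≤ j.N := by exact_mod_cast Nat.one_le_iff_ne_zero.mpr (NeZero.ne j.N)
    have hQ₀1 : 1 ≤ Q₀ := by rw [hQ₀]; nlinarith
    have hQ₀0 : 0 < Q₀ := by linarith
    -- `max(1, Q) ≤ c₁' Q₀^{c₂'}`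
    have hQc : (1 : ℝ) ≤ Q₀ ^ c₂' := Real.one_le_rpow hQ₀1 hc₂'0
    have hmax : max 1 D.Q ≤ c₁' * Q₀ ^ c₂' := by
      refine max_le (one_le_mul_of_one_le_of_one_le hc₁'1 hQc) (hQ.trans ?_)
      have h1 : Q₀ ^ c₂ ≤ Q₀ ^ c₂' := Real.rpow_le_rpow_of_exponent_le hQ₀1 (le_max_left _ _)
      have h2 : 0 ≤ Q₀ ^ c₂ := Real.rpow_nonneg hQ₀0.le _
      calc c₁ * Q₀ ^ c₂ ≤ c₁' * Q₀ ^ c₂ := mul_le_mul_of_nonneg_right (le_max_right _ _) h2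
        _ ≤ c₁' * Q₀ ^ c₂' := mul_le_mul_of_nonneg_left h1 (by linarith)
    have h6 : max 1 D.Q ^ K ≤ (c₁' * Q₀ ^ c₂') ^ K :=
      Real.rpow_le_rpow (le_trans zero_le_one (le_max_left _ _)) hmax hK
    have h7 : (c₁' * Q₀ ^ c₂') ^ K = c₁' ^ K * Q₀ ^ (K * c₂') := by
      rw [Real.mul_rpow (by linarith) (Real.rpow_nonneg hQ₀0.le _), ← Real.rpow_mul hQ₀0.le,
        mul_comm c₂' K]
    have h8 : Q₀ ^ κ₂ = Q₀ ^ (K * c₂') * Q₀ ^ (m + 18) := by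
      rw [hκ₂, Real.rpow_add hQ₀0, Real.rpow_natCast]
    calc C * max 1 D.Q ^ K * Q₀ ^ (m + 18)
        ≤ C * (c₁' ^ K * Q₀ ^ (K * c₂')) * Q₀ ^ (m + 18) := by
          rw [← h7]
          exact mul_le_mul_of_nonneg_right (mul_le_mul_of_nonneg_left h6 hC.le) (by positivity)
      _ = B₂ * Q₀ ^ κ₂ := by rw [hB₂, h8]; ring
  -- choose the continuations
  let G : EllipticNewformIndex → EllipticNewformIndex → ℂ → ℂ := fun i j ↦
    if hij : ¬ i.W.HasCM ∧ ¬ j.W.HasCM ∧ ¬ TwistEquiv i j then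
      (hpair i j hij.1 hij.2.1 hij.2.2).choose
    else fun _ ↦ 0
  have hG : ∀ i j (hi : ¬ i.W.HasCM) (hj : ¬ j.W.HasCM) (hij : ¬ TwistEquiv i j),
      G i j = (hpair i j hi hj hij).choose := fun i j hi hj hij ↦ by
    show (if hij : ¬ i.W.HasCM ∧ ¬ j.W.HasCM ∧ ¬ TwistEquiv i j then
      (hpair i j hij.1 hij.2.1 hij.2.2).choose else fun _ ↦ 0) = _
    rw [dif_pos (⟨hi, hj, hij⟩ : ¬ i.W.HasCM ∧ ¬ j.W.HasCM ∧ ¬ TwistEquiv i j)]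
  refine murty_petersson_newform_lower_bound_of_pairContinuation' G
    (fun i j hi hj hij ↦ ?_) (fun i j hi hj hij ↦ ?_) hB₂0 hκ₂0 (fun i j hi hj hij ↦ ?_)
  · rw [hG i j hi hj hij]; exact (hpair i j hi hj hij).choose_spec.1
  · rw [hG i j hi hj hij]; exact (hpair i j hi hj hij).choose_spec.2.1
  · rw [hG i j hi hj hij]; exact (hpair i j hi hj hij).choose_spec.2.2

end Selberg

end Literature.NumberTheory.EllipticCurves.ModularForms

end
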